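import Literature.NumberTheory.EllipticCurves.SqrtTwoTwistThetaDictionary
import Literature.NumberTheory.EllipticCurves.IsogenyTwoTorsionProofs
import Literature.NumberTheory.EllipticCurves.ComplexMultiplicationLFunctionIsogenyHoldsProofs
import HarnessLib

/-!
# `L(B_n, s)` is entire for every square-free `n` (even `n` by the `[√-2]`-isogeny `B_m → B_{−2m}`) — modulo Brewer's character sum

Topic `Literature/NumberTheory/EllipticCurves`, namespace `Literature.NumberTheory.EllipticCurves.SqrtTwoTwist` (sequel to
`SqrtTwoTwistThetaDictionary`).  THEOREMS ONLY.  The `ℤ[√-2]`-twin of `QuarticTwistEntireLFunction` / `SexticTwistEntireLFunction`.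

`SqrtTwoTwistThetaDictionary.hasEntireLFunction_of_brewer` gives the entire continuation of `L(B_n, s)`,
`B_n = ⟨0, 4n, 0, 2n², 0⟩ : y² = x³ + 4n x² + 2n² x`, for `n` ODD and square-free (where the model is minimal at `2` by Silverman's
criterion).  For EVEN square-free `n = −2m` (`m` odd square-free) the curve `B_{−2m} = ⟨0, −8m, 0, 8m², 0⟩` is the codomain of
Silverman's explicit `2`-isogeny on `B_m` (*AEC* III.4.5; the tree's `twoIsogenyCodomain ⟨0, a, 0, b, 0⟩ = ⟨0, −2a, 0, a² − 4b, 0⟩` — this is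
the complex multiplication `[√-2] : B → B^{(−2)}`), so `L(B_{−2m}, s) = L(B_m, s)` by the tree's theorem "`ℚ`-isogenous curves have the
same `L`-series" (`IsIsogenous.LSeries_eq`, Faltings / Knapp 11.67, proved in `ComplexMultiplicationLFunctionIsogenyHoldsProofs`).  Hence:

* `hasEntireLFunction_of_LSeries_eq` — `HasEntireLFunction` only depends on `W.LSeries`;
* `isIsogenous_B_neg_two_mul` — `B_m ~ B_{−2m}` over `ℚ`;
* ★ `hasEntireLFunction_of_brewer_of_squarefree` — **`(⟨0, 4n, 0, 2n², 0⟩ : WeierstrassCurve ℚ).HasEntireLFunction` for EVERY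
  square-free `n ∈ ℤ`** (so for every elliptic curve over `ℚ` with `j = 8000`, each having such a model up to `ℚ`-isomorphism),
  modulo `Brewer1961_characterSum`.

Nothing about BSD is proved here.

## References
* J. H. Silverman, *The Arithmetic of Elliptic Curves*, 2nd ed. (2009), III.4 Example 4.5, App. C §16. [SilvermanAEC2009]
* A. W. Knapp, *Elliptic Curves* (1992), Thm. 11.67. [Knapp1993]
* A. R. Rajwade, *Arithmetic on curves with complex multiplication by √−2*, Proc. Cambridge Philos. Soc. 64 (1968). [Rajwade1968]

## Mathlib / tree search
Tree: `SqrtTwoTwist.hasEntireLFunction_of_brewer`, `SqrtTwoTwist.isElliptic_B`, `WeierstrassCurve.isIsogenous_of_eq_twoIsogenyCodomain`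
(`IsogenyTwoTorsionProofs`), `WeierstrassCurve.IsIsogenous.LSeries_eq` (`ComplexMultiplicationLFunctionIsogenyHoldsProofs`),
`WeierstrassCurve.HasEntireLFunction` (`AnalyticRank`).  Mathlib: `Squarefree.of_mul_right`, `Int.even_or_odd`, `Int.isUnit_iff`.
-/

noncomputable section

open scoped Classical

namespace Literature.NumberTheory.EllipticCurves

namespace SqrtTwoTwist

open _root_.WeierstrassCurve

/-- `HasEntireLFunction` depends only on the `L`-series: curves with equal `W.LSeries` have the same entire continuations.
[cite: SilvermanAEC2009, App. C §16] -/
theorem hasEntireLFunction_of_LSeries_eq {W W' : WeierstrassCurve ℚ} (h : W.LSeries = W'.LSeries)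
    (hW : W.HasEntireLFunction) : W'.HasEntireLFunction := by
  obtain ⟨g, hg, hgs⟩ := hW
  exact ⟨g, hg, fun s hs ↦ by rw [← h]; exact hgs s hs⟩

/-- **`B_m ~ B_{−2m}` over `ℚ`**: `⟨0, −8m, 0, 8m², 0⟩` is the codomain `⟨0, −2a, 0, a² − 4b, 0⟩` of Silverman's `2`-isogeny on
`B_m = ⟨0, 4m, 0, 2m², 0⟩` (the complex multiplication `[√-2]`). [cite: SilvermanAEC2009, III.4 Example 4.5] -/
theorem isIsogenous_B_neg_two_mul {m : ℚ} (hm : m ≠ 0) :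
    haveI := isElliptic_B hm two_ne_zero
    IsIsogenous (⟨0, 4 * m, 0, 2 * m ^ 2, 0⟩ : WeierstrassCurve ℚ) (⟨0, 4 * (-2 * m), 0, 2 * (-2 * m) ^ 2, 0⟩ : WeierstrassCurve ℚ) := by
  haveI := isElliptic_B hm two_ne_zero
  refine isIsogenous_of_eq_twoIsogenyCodomain _ ?_
  ext <;> simp [twoIsogenyCodomain] <;> ring

/-- **`L(B_{−2m}, s)` is entire for `m` odd square-free**, modulo Brewer's theorem: transport along the isogeny `B_m → B_{−2m}`
(`IsIsogenous.LSeries_eq`). [cite: SilvermanAEC2009, III.4 Example 4.5 and App. C §16] [cite: Knapp1993, Thm. 11.67] -/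
theorem hasEntireLFunction_neg_two_mul_of_brewer (hB : Brewer1961_characterSum) {m : ℤ} (hm : Squarefree m) (hodd : Odd m) :
    (⟨0, 4 * ((-2 * m : ℤ) : ℚ), 0, 2 * ((-2 * m : ℤ) : ℚ) ^ 2, 0⟩ : WeierstrassCurve ℚ).HasEntireLFunction := by
  have hm0 : (m : ℚ) ≠ 0 := by
    rw [Int.cast_ne_zero]; rintro rfl; exact Int.not_even_iff_odd.mpr hodd (by decide)
  have h2m0 : ((-2 * m : ℤ) : ℚ) ≠ 0 := by push_cast; exact mul_ne_zero (by norm_num) hm0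
  haveI := isElliptic_B hm0 two_ne_zero
  haveI := isElliptic_B h2m0 two_ne_zero
  have hiso : IsIsogenous (⟨0, 4 * (m : ℚ), 0, 2 * (m : ℚ) ^ 2, 0⟩ : WeierstrassCurve ℚ)
      (⟨0, 4 * ((-2 * m : ℤ) : ℚ), 0, 2 * ((-2 * m : ℤ) : ℚ) ^ 2, 0⟩ : WeierstrassCurve ℚ) := by
    have h := isIsogenous_B_neg_two_mul hm0
    push_cast
    exact h
  exact hasEntireLFunction_of_LSeries_eq hiso.LSeries_eq (hasEntireLFunction_of_brewer hB hm hodd)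

/-- ★ **`L(B_n, s)` is entire for every square-free `n ∈ ℤ`, modulo Brewer's character sum** (`n` odd:
`hasEntireLFunction_of_brewer`; `n` even: `n = −2(−n/2)` with `−n/2` odd square-free and the isogeny `B_{−n/2} → B_n`).  Every elliptic curve
over `ℚ` with `j = 8000` is `ℚ`-isomorphic to such a `B_n`. [cite: Rajwade1968, Thm. 1 and §5] [cite: SilvermanAEC2009, App. C §16] -/
theorem hasEntireLFunction_of_brewer_of_squarefree (hB : Brewer1961_characterSum) {n : ℤ} (hn : Squarefree n) :
    (⟨0, 4 * (n : ℚ), 0, 2 * (n : ℚ) ^ 2, 0⟩ : WeierstrassCurve ℚ).HasEntireLFunction := by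
  rcases Int.even_or_odd n with ⟨k, hk⟩ | hodd
  · -- `n = 2k = -2 (-k)` with `-k` odd square-free
    have hk2 : n = 2 * k := by rw [hk]; ring
    have hksq : Squarefree k := by rw [hk2] at hn; exact Squarefree.of_mul_right hn
    have hkodd : Odd k := by
      rw [← Int.not_even_iff_odd]
      rintro ⟨j, rfl⟩
      have h4 : (2 : ℤ) * 2 ∣ n := ⟨j, by rw [hk2]; ring⟩
      have := hn 2 h4
      rw [Int.isUnit_iff] at this
      omega
    have h := hasEntireLFunction_neg_two_mul_of_brewer hB
      (Squarefree.squarefree_of_dvd (neg_dvd.mpr dvd_rfl) hksq) hkodd.neg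
    have hcast : ((-2 * -k : ℤ) : ℚ) = (n : ℚ) := by rw [hk2]; push_cast; ring
    rwa [hcast] at h
  · exact hasEntireLFunction_of_brewer hB hn hodd

end SqrtTwoTwist

end Literature.NumberTheory.EllipticCurves

end
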